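import Mathlib
import Summits.CriticalPhenomena.CardyFormulaZ2.Theorems.CardyFlipRussoSquareFromVoronoiHubFaithfulDefs
import Summits.CriticalPhenomena.CardyFormulaZ2.Theorems.CardyFlipRussoSquareFromVoronoiHubFatTubePart3
import Literature.Probability.Percolation.TriVoronoiCells

/-!
# Fat tubes in defect-free Voronoi tessellations: the fat tube lemma (`stub_fatTube`)

Crux `Summit.CriticalPhenomena.CardyFormulaZ2.Theses.CardyFlipRusso.SquareFromVoronoiHub`
(stmt-CriticalPhenomena-6434), line `Sketch`, registered stub `stub_fatTube` of the reshaped K1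
("faithful discretisation"; design `Cruxes/SquareFromVoronoiHub/Lines/Sketch.lean`).
**Statement.**  Under `(B, W) ∈ noDefect V ρ r₂ ℓ₀` with margins `4μ ≤ r₂`, `64μρ ≤ ℓ₀r₂`, a black
continuum path `γ` whose `8ρ`-neighbourhood lies in the window `V` has `μ ∈ tubeMargins B W ρ γ`:
there is a path `γ'` from within `4ρ` of the start of `γ` to within `4ρ` of its end, every point
within `4ρ` of `γ`, all of whose open `μ`-balls are STRICTLY black.

**Proof.**  Each `γ t` lies in the cell of a black nucleus at distance `< ρ` (Part 1
`exists_black_cell`); these finitely many closed cells cover the connected set `range γ`, so the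
nuclei of the cells of `γ 0` and `γ 1` are joined by a chain of black nuclei whose consecutive
cells meet ON `range γ` (`reflTransGen_of_isPreconnected_of_finite_cover`).  For two consecutive
nuclei `b ≠ b'` the door lemma (Part 3 `exists_door`) gives a bisector point `m` within `ρ` of both
which is `μ`-DEEP for `b` and for `b'`; since `b` is `μ`-deep for itself and the deep set is convex
(Part 1), the polygonal path `b → m → b'` consists of `μ`-deep points, whose `μ`-balls are strictly
black (Part 1 `ball_subset_setOf_infDist_lt_of_deep`), and it stays within `2ρ` of the common cell
point on `γ`.  Concatenating along the chain (`JoinedIn.trans`) gives `γ'`.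
-/

noncomputable section

namespace Summit.CriticalPhenomena.CardyFormulaZ2.Cruxes.SquareFromVoronoiHub.VoronoiBlocks.Faithful

open scoped Topology
open Set Metric
open Literature.Probability.Percolation (blackRegion mem_blackRegion
  reflTransGen_of_isPreconnected_of_finite_cover)
open Literature.Probability.LatticeModels (voronoiCell mem_voronoiCell_iff self_mem_voronoiCell)

/-- **One door step.**  Under the local no-defect clauses, two distinct BLACK nuclei `b, b'`
whose cells share a point `z₀` with `closedBall z₀ (7ρ) ⊆ V` are joined, inside the set of points
`P` with `ball P μ` strictly black and `dist P z₀ ≤ 2ρ`, by the polygonal path through the door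
of Part 3. [folklore] -/
theorem joinedIn_of_adjacent_black_cells {B W V : Set ℂ} {ρ r₂ ℓ₀ μ : ℝ} (hρ : 0 < ρ)
    (hr₂ : 0 < r₂) (hℓ₀ : 0 < ℓ₀) (hμ : 0 < μ) (h4 : 4 * μ ≤ r₂) (h64 : 64 * μ * ρ ≤ ℓ₀ * r₂)
    (hW : W.Nonempty) (hcov : ∀ z ∈ V, ∃ p ∈ B ∪ W, dist z p < ρ)
    (hsep : ∀ p ∈ B ∪ W, ∀ q ∈ B ∪ W, p ∈ V → dist p q < r₂ → p = q)
    (hdisj : ∀ p ∈ V, p ∈ B → p ∉ W)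
    (hedge : ∀ p ∈ B ∪ W, ∀ q ∈ B ∪ W, ∀ r ∈ B ∪ W, ∀ r' ∈ B ∪ W, ∀ v v' : ℂ, p ∈ V →
      p ≠ q → p ≠ r → q ≠ r → p ≠ r' → q ≠ r' → r ≠ r' →
      dist p v = dist q v → dist q v = dist r v → dist p v ≤ 2 * ρ →
      dist p v' = dist q v' → dist q v' = dist r' v' → dist p v' ≤ 2 * ρ → ℓ₀ ≤ dist v v')
    {b b' z₀ : ℂ} (hb : b ∈ B) (hb' : b' ∈ B) (hbb' : b ≠ b')
    (hzb : z₀ ∈ voronoiCell (B ∪ W) b) (hzb' : z₀ ∈ voronoiCell (B ∪ W) b')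
    (hV : closedBall z₀ (7 * ρ) ⊆ V) :
    JoinedIn {P : ℂ | ball P μ ⊆ {y : ℂ | infDist y B < infDist y W} ∧ dist P z₀ ≤ 2 * ρ} b b' := by
  have hwin : ∀ z, dist z z₀ ≤ 7 * ρ → z ∈ V := fun z hz => hV (mem_closedBall.2 hz)
  obtain ⟨p, hp, hz₀p⟩ := hcov z₀ (hV (mem_closedBall_self (by positivity)))
  have hdb : dist z₀ b < ρ := (hzb p hp).trans_lt hz₀p
  have hdb' : dist z₀ b' < ρ := (hzb' p hp).trans_lt hz₀p
  have hbV : b ∈ V := hwin b (by rw [dist_comm]; linarith)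
  have hb'V : b' ∈ V := hwin b' (by rw [dist_comm]; linarith)
  have hsepW : ∀ b₂ ∈ B, b₂ ∈ V → ∀ w ∈ W, r₂ ≤ dist w b₂ := fun b₂ hb₂ hb₂V w hw => by
    rw [dist_comm]
    exact not_lt.1 fun h => hdisj b₂ hb₂V hb₂ ((hsep b₂ (Or.inl hb₂) w (Or.inr hw) hb₂V h) ▸ hw)
  obtain ⟨m, hmb, hmbb', hdeep⟩ := exists_door hρ hr₂ hℓ₀ hμ h4 h64 hcov hsep hedge (Or.inl hb)
    (Or.inl hb') hbb' hzb hzb' hV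
  have hwb : ∀ w ∈ W, w ≠ b := fun w hw h => hdisj b hbV hb (h ▸ hw)
  have hwb' : ∀ w ∈ W, w ≠ b' := fun w hw h => hdisj b' hb'V hb' (h ▸ hw)
  -- a segment from a black nucleus to a point that is deep for it lies in the good set
  have hseg : ∀ b₂ : ℂ, b₂ ∈ B → b₂ ∈ V → dist z₀ b₂ < ρ → dist m b₂ < ρ →
      (∀ w ∈ W, 2 * μ * dist w b₂ ≤ dist m w ^ 2 - dist m b₂ ^ 2) →
      segment ℝ b₂ m ⊆ {P : ℂ | ball P μ ⊆ {y : ℂ | infDist y B < infDist y W} ∧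
        dist P z₀ ≤ 2 * ρ} := by
    intro b₂ hb₂B hb₂V hdb₂ hmb₂ hmd P hP
    constructor
    · have hPdeep : P ∈ {z : ℂ | ∀ w ∈ W, 2 * μ * dist w b₂ ≤ dist z w ^ 2 - dist z b₂ ^ 2} :=
        (convex_setOf_deep W b₂ μ).segment_subset
          (self_mem_setOf_deep (by linarith) (hsepW b₂ hb₂B hb₂V)) hmd hP
      exact ball_subset_setOf_infDist_lt_of_deep hb₂B hW hr₂ (hsepW b₂ hb₂B hb₂V) hPdeep
    · have hPball : P ∈ closedBall z₀ (2 * ρ) :=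
        (convex_closedBall z₀ (2 * ρ)).segment_subset
          (mem_closedBall.2 (by rw [dist_comm]; linarith))
          (mem_closedBall.2 (by
            have := dist_triangle m b₂ z₀; rw [dist_comm b₂ z₀] at this; linarith)) hP
      exact mem_closedBall.1 hPball
  have h1 : JoinedIn _ b m := JoinedIn.of_segment_subset (hseg b hb hbV hdb hmb
    fun w hw => (hdeep w (Or.inr hw) (hwb w hw) (hwb' w hw)).1)
  have h2 : JoinedIn _ b' m := JoinedIn.of_segment_subset (hseg b' hb' hb'V hdb'
    (by rw [← hmbb']; exact hmb) fun w hw => (hdeep w (Or.inr hw) (hwb w hw) (hwb' w hw)).2)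
  exact h1.trans h2.symm

/-- **Fat tube lemma** (deterministic Voronoi geometry; registered stub `stub_fatTube` of line
`Sketch`).  Under `(B, W) ∈ noDefect V ρ r₂ ℓ₀` with margins `4μ ≤ r₂`, `64 μ ρ ≤ ℓ₀ r₂`, a black
continuum path `γ` whose `8ρ`-neighbourhood lies in `V` has `μ ∈ tubeMargins B W ρ γ`: follow
the chain of black Voronoi cells of `B ∪ W` visited by `γ`, through nucleus → door → nucleus
(see the module docstring).  For the WHITE tube apply it to `(W, B)` (`mem_noDefect_swap`).
[folklore] -/
theorem stub_fatTube : ∀ {B W V : Set ℂ} {ρ r₂ ℓ₀ μ : ℝ}, 0 < ρ → 0 < r₂ → 0 < ℓ₀ → 0 < μ →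
    4 * μ ≤ r₂ → 64 * μ * ρ ≤ ℓ₀ * r₂ → (B, W) ∈ noDefect V ρ r₂ ℓ₀ →
    ∀ {x y : ℂ} (γ : Path x y), cthickening (8 * ρ) (range γ) ⊆ V →
    (∀ t, γ t ∈ blackRegion B W) → μ ∈ tubeMargins B W ρ γ := by
  intro B W V ρ r₂ ℓ₀ μ hρ hr₂ hℓ₀ hμ h4 h64 hnd x y γ hV hblack
  obtain ⟨⟨hBV, hWV⟩, hcov, hsep, hdisj, hedge⟩ := hnd
  dsimp only at hBV hWV hcov hsep hdisj hedge
  have hB : B.Nonempty := hBV.mono inter_subset_left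
  have hW : W.Nonempty := hWV.mono inter_subset_left
  -- the window
  have hwin : ∀ (z : ℂ) (t : unitInterval), dist z (γ t) ≤ 8 * ρ → z ∈ V := fun z t h =>
    hV (mem_cthickening_of_dist_le z (γ t) (8 * ρ) (range γ) (mem_range_self t) h)
  -- every point of `γ` lies in the cell of a black nucleus at distance `< ρ`
  have hcell : ∀ t, ∃ b ∈ B, γ t ∈ voronoiCell (B ∪ W) b ∧ dist (γ t) b < ρ := fun t =>
    exists_black_cell hρ hr₂ hB hcov hsep
      (fun z hz => hwin z t (by have := mem_closedBall.1 hz; linarith)) (hblack t)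
  -- the finitely many black nuclei near `γ`
  obtain ⟨R, hR⟩ := (isCompact_range γ.continuous).isBounded.subset_closedBall x
  set F : Set ℂ := {b | b ∈ B ∧ ∃ t, dist (γ t) b < ρ} with hF
  have hFV : ∀ b ∈ F, b ∈ V := fun b hb => by
    obtain ⟨-, t, ht⟩ := hb
    exact hwin b t (by rw [dist_comm]; linarith)
  have hFfin : F.Finite := by
    refine finite_of_isBounded_of_sep hr₂
      ((isBounded_closedBall (x := x) (r := R + ρ)).subset fun b hb => ?_)
      fun p hp q hq hpq => hsep p (Or.inl hp.1) q (Or.inl hq.1) (hFV p hp) hpq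
    obtain ⟨-, t, ht⟩ := hb
    have h1 := mem_closedBall.1 (hR (mem_range_self t))
    have h2 := dist_triangle b (γ t) x
    rw [dist_comm b (γ t)] at h2
    exact mem_closedBall.2 (by linarith)
  have hcovK : range γ ⊆ ⋃ b ∈ F, voronoiCell (B ∪ W) b := by
    rintro _ ⟨t, rfl⟩
    obtain ⟨b, hb, hbt, hd⟩ := hcell t
    exact mem_iUnion₂.2 ⟨b, ⟨hb, t, hd⟩, hbt⟩
  obtain ⟨b₀, hb₀B, hb₀x, hb₀d⟩ := hcell 0
  obtain ⟨b₁, hb₁B, hb₁y, hb₁d⟩ := hcell 1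
  have hchain := reflTransGen_of_isPreconnected_of_finite_cover
    (isPreconnected_range γ.continuous) hFfin (A := fun b => voronoiCell (B ∪ W) b)
    (fun b _ => isClosed_voronoiCell' (B ∪ W) b) hcovK (i₀ := b₀) (i₁ := b₁) ⟨hb₀B, 0, hb₀d⟩
    ⟨γ 0, mem_range_self _, hb₀x⟩ ⟨hb₁B, 1, hb₁d⟩ ⟨γ 1, mem_range_self _, hb₁y⟩
  -- the good set, containing the nuclei of `F`
  set G : Set ℂ := {P : ℂ | ball P μ ⊆ strictBlack B W ∧ ∃ s, dist P (γ s) ≤ 4 * ρ} with hG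
  have hsepW : ∀ b ∈ B, b ∈ V → ∀ w ∈ W, r₂ ≤ dist w b := fun b hb hbV w hw => by
    rw [dist_comm]
    exact not_lt.1 fun h => hdisj b hbV hb ((hsep b (Or.inl hb) w (Or.inr hw) hbV h) ▸ hw)
  have hFG : ∀ b ∈ F, b ∈ G := fun b hb => by
    obtain ⟨hbB, t, hbt⟩ := hb
    have hbV : b ∈ V := hFV b ⟨hbB, t, hbt⟩
    exact ⟨ball_subset_setOf_infDist_lt_of_deep hbB hW hr₂ (hsepW b hbB hbV)
      (self_mem_setOf_deep (by linarith) (hsepW b hbB hbV)), t, by rw [dist_comm]; linarith⟩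
  -- one step of the chain
  have hstep : ∀ b b' : ℂ, b ∈ F → b' ∈ F →
      (range γ ∩ voronoiCell (B ∪ W) b ∩ voronoiCell (B ∪ W) b').Nonempty → JoinedIn G b b' := by
    rintro b b' hbF hb'F ⟨z₀, ⟨⟨s₀, hs₀⟩, hzb⟩, hzb'⟩
    by_cases hbb' : b = b'
    · subst hbb'; exact JoinedIn.refl (hFG b hbF)
    have hz₀V : closedBall z₀ (7 * ρ) ⊆ V := fun z hz =>
      hwin z s₀ (by rw [hs₀]; have := mem_closedBall.1 hz; linarith)
    refine (joinedIn_of_adjacent_black_cells hρ hr₂ hℓ₀ hμ h4 h64 hW hcov hsep hdisj hedge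
      hbF.1 hb'F.1 hbb' hzb hzb' hz₀V).mono fun P hP => ⟨hP.1, s₀, ?_⟩
    rw [hs₀]; linarith [hP.2]
  -- along the chain
  have hjoin : JoinedIn G b₀ b₁ := by
    clear hb₁y hb₁d hb₁B
    induction hchain with
    | refl => exact JoinedIn.refl (hFG b₀ ⟨hb₀B, 0, hb₀d⟩)
    | tail _ hst ih =>
      obtain ⟨hsF, htF, hne⟩ := hst
      exact ih.trans (hstep _ _ hsF htF hne)
  obtain ⟨γ', hγ'⟩ := hjoin
  refine ⟨b₀, b₁, γ', ?_, ?_, fun t => (hγ' t).2, fun t => (hγ' t).1⟩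
  · have h := hb₀d
    rw [γ.source] at h
    rw [dist_comm]; linarith
  · have h := hb₁d
    rw [γ.target] at h
    rw [dist_comm]; linarith

end Summit.CriticalPhenomena.CardyFormulaZ2.Cruxes.SquareFromVoronoiHub.VoronoiBlocks.Faithful

end
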